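import Summits.AtomisticToContinuum.HydrodynamicLimit.Theorems.AntiMazurCoboundariesCellForecastPressureDecayEnskogObjects
import Literature.MathematicalPhysics.StatisticalMechanics.HardCoreCanonical
import HarnessLib

/-!
# S2c(A) · the two-marked decorated expansion with a two-body weight
# (first file of stub `stub_contactStatistics`, crux line `enskog-compensator-martingale`,
# crux `CellForecastPressureDecay`, stmt-AtomisticToContinuum-13915)

Generic cluster-expansion identities and bounds for the canonical hard-core gas of independent points
(`Literature/MathematicalPhysics/StatisticalMechanics/HardCoreCanonical`: labels `ι`, one-point law `ν`,
overlap relation `O`, Ursell weights `u_B`, hard-core indicator `𝟙[W]`, `Ξ(W) = ℙ(no overlap in W)`), needed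
by the near-contact pair statistics `ContactStatistics` of the line (the law of `xᵢ − xⱼ` under the uniform
hard-core law of the cell is tested against TWO-BODY weights `Φ(xᵢ, xⱼ) = φ(xᵢ − xⱼ)`):

* § 1 `integral_mul₂_efR_eq_sum` — **the decorated expansion with two marked particles and a two-body
  weight**: for `i, j ∈ W`,
  `∫ Φ(xᵢ,xⱼ) 𝟙[W] dℙ = ∑_{B ∋ i,j} (∫ Φ u_B) Ξ(W∖B) + ∑_{B ∋ i, B ∌ j} ∑_{B' ⊆ W∖B, B' ∋ j} (∫ Φ u_B u_{B'}) Ξ(W∖B∖B')`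
  (expand the block of `i`; if `j` is not in it, expand the block of `j` in the rest; factorise over disjoint
  label sets). The ratios `Ξ(W∖B)/Ξ(W)` only depend on `#B` (`hcProb_eq_of_card_eq`), so all the dependence
  on the two-body weight sits in the local brackets.
* § 2 the registered sub-goal `stub_contactStatistics_expansion` (labels `Fin n`, points in `ℝ³`).
The tree bounds with two-body weights and the tail (tree-sum) machinery that control the terms of this expansion
are in the two companion files of the stub.

References: E. Pulvirenti, D. Tsagkarogiannis, Comm. Math. Phys. 316 (2012) 289–306, §3 (polymer
representation of the canonical partition function with marked particles), §4 (tree-graph bound);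
S. Friedli, Y. Velenik, *Statistical Mechanics of Lattice Systems* (2017), §5.4.
-/

noncomputable section

open MeasureTheory ProbabilityTheory Set Filter Finset
open scoped ENNReal BigOperators
open Literature.Analysis.FluidPDE Literature.MathematicalPhysics.KineticTheory
open Literature.MathematicalPhysics.StatisticalMechanics
open Literature.Probability.LatticeModels (setPartitions mem_setPartitions IsSetPartition treeNumber
  sum_setPartitions_prod_card_mul_treeNumber blockOf)

namespace Summit.AtomisticToContinuum.HydrodynamicLimit.Theorems.EnskogCompensator

section Generic

variable {ι : Type*} [Fintype ι] [DecidableEq ι] {X : Type*} [MeasurableSpace X] {O : X → X → Prop}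
variable (ν : Measure X) [IsProbabilityMeasure ν]

/-! ## § 1 The decorated expansion with two marked particles and a two-body weight -/

/-- **The decorated expansion with two marked particles and a two-body weight.** For `i, j ∈ W` and a
bounded jointly measurable `Φ`,
`∫ Φ(xᵢ,xⱼ) 𝟙[hardCoreSet W] dℙ = ∑_{B ∋ i, j} (∫ Φ(xᵢ,xⱼ) u_B) Ξ(W ∖ B)`
`+ ∑_{B ∋ i, B ∌ j} ∑_{B' ⊆ W ∖ B, B' ∋ j} (∫ Φ(xᵢ,xⱼ) u_B u_{B'}) Ξ((W ∖ B) ∖ B')`: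
expand the block `B` of `i` (`efR_eq_sum_uR_mul_efR`); if `j ∉ B` expand the block `B'` of `j` in
`W ∖ B` once more; the bracket depends on the labels `B ∪ B'` only and the remaining hard-core indicator on
the complementary labels, so the integral factorises (`integral_mul_eq_of_dependsOn`).
[cite: PulvirentiTsagkarogiannis2012, §3] -/
theorem integral_mul₂_efR_eq_sum (hO : MeasurableSet {p : X × X | O p.1 p.2}) {W : Finset ι} {i j : ι}
    (hi : i ∈ W) (hj : j ∈ W) {Φ : X → X → ℝ} (hΦ : Measurable fun p : X × X => Φ p.1 p.2) {C : ℝ}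
    (hΦC : ∀ a b, |Φ a b| ≤ C) :
    ∫ x, Φ (x i) (x j) * efR O x W ∂Measure.pi (fun _ : ι => ν) =
      ∑ B ∈ (W.powerset.filter (fun B => i ∈ B)).filter (fun B => j ∈ B),
          (∫ x, Φ (x i) (x j) * uR O x B ∂Measure.pi (fun _ : ι => ν)) * hcProb O ν (W \ B) +
        ∑ B ∈ (W.powerset.filter (fun B => i ∈ B)).filter (fun B => j ∉ B),
          ∑ B' ∈ (W \ B).powerset.filter (fun B' => j ∈ B'),
            (∫ x, Φ (x i) (x j) * (uR O x B * uR O x B') ∂Measure.pi (fun _ : ι => ν)) *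
              hcProb O ν ((W \ B) \ B') := by
  have hΦij : Measurable fun x : ι → X => Φ (x i) (x j) :=
    hΦ.comp (f := fun x : ι → X => (x i, x j)) ((measurable_pi_apply i).prodMk (measurable_pi_apply j))
  have hC : ∀ x : ι → X, |Φ (x i) (x j)| ≤ |C| := fun x => (hΦC _ _).trans (le_abs_self C)
  -- expand the block of `i`
  have hpt : ∀ x : ι → X, Φ (x i) (x j) * efR O x W =
      ∑ B ∈ W.powerset.filter (fun B => i ∈ B), Φ (x i) (x j) * uR O x B * efR O x (W \ B) := by
    intro x
    rw [efR_eq_sum_uR_mul_efR x hi, mul_sum]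
    simp_rw [mul_assoc]
  simp_rw [hpt]
  have hintB : ∀ B ∈ W.powerset.filter (fun B => i ∈ B),
      Integrable (fun x : ι → X => Φ (x i) (x j) * uR O x B * efR O x (W \ B))
        (Measure.pi fun _ : ι => ν) := by
    intro B _
    refine integrable_pi_of_bounded ν ((hΦij.mul (measurable_uR hO B)).mul (measurable_efR hO _))
      (C := |C| * Literature.Probability.LatticeModels.hcUrsellBound B * 1) fun x => ?_
    rw [abs_mul, abs_mul]
    exact mul_le_mul (mul_le_mul (hC x) (abs_uR_le x B) (abs_nonneg _) (abs_nonneg _))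
      (abs_efR_le_one x _) (abs_nonneg _) (by positivity)
  rw [integral_finsetSum _ hintB, ← sum_filter_add_sum_filter_not _ (fun B => j ∈ B)]
  congr 1
  · -- `j ∈ B`: factorise over `B` and `W \ B`
    refine sum_congr rfl fun B hB => ?_
    obtain ⟨hB, hjB⟩ := mem_filter.1 hB
    obtain ⟨-, hiB⟩ := mem_filter.1 hB
    have hdep1 : DependsOn (fun x : ι → X => Φ (x i) (x j) * uR O x B) (B : Set ι) := by
      intro x y hxy
      have h2 : uR O x B = uR O y B := dependsOn_uR B hxy
      simp only
      rw [hxy i hiB, hxy j hjB, h2]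
    have hfac := integral_mul_eq_of_dependsOn ν (disjoint_sdiff (s := B) (t := W))
      (F := fun x => Φ (x i) (x j) * uR O x B) (G := fun x => efR O x (W \ B))
      (hΦij.mul (measurable_uR hO B)) (measurable_efR hO _) hdep1 (dependsOn_efR _)
    rw [hfac, integral_efR ν hO]
  · -- `j ∉ B`: expand the block of `j` in `W \ B`, factorise over `B ∪ B'` and `(W \ B) \ B'`
    refine sum_congr rfl fun B hB => ?_
    obtain ⟨hB, hjB⟩ := mem_filter.1 hB
    obtain ⟨-, hiB⟩ := mem_filter.1 hB
    have hjWB : j ∈ W \ B := mem_sdiff.2 ⟨hj, hjB⟩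
    have hpt2 : ∀ x : ι → X, Φ (x i) (x j) * uR O x B * efR O x (W \ B) =
        ∑ B' ∈ (W \ B).powerset.filter (fun B' => j ∈ B'),
          Φ (x i) (x j) * (uR O x B * uR O x B') * efR O x ((W \ B) \ B') := by
      intro x
      rw [efR_eq_sum_uR_mul_efR x hjWB, mul_sum]
      exact sum_congr rfl fun B' _ => by ring
    simp_rw [hpt2]
    have hintB' : ∀ B' ∈ (W \ B).powerset.filter (fun B' => j ∈ B'),
        Integrable (fun x : ι → X => Φ (x i) (x j) * (uR O x B * uR O x B') * efR O x ((W \ B) \ B'))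
          (Measure.pi fun _ : ι => ν) := by
      intro B' _
      refine integrable_pi_of_bounded ν
        ((hΦij.mul ((measurable_uR hO B).mul (measurable_uR hO B'))).mul (measurable_efR hO _))
        (C := |C| * (Literature.Probability.LatticeModels.hcUrsellBound B *
          Literature.Probability.LatticeModels.hcUrsellBound B') * 1) fun x => ?_
      rw [abs_mul, abs_mul, abs_mul]
      exact mul_le_mul (mul_le_mul (hC x) (mul_le_mul (abs_uR_le x B) (abs_uR_le x B') (abs_nonneg _)
        (by positivity)) (by positivity) (abs_nonneg _)) (abs_efR_le_one x _) (abs_nonneg _) (by positivity)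
    rw [integral_finsetSum _ hintB']
    refine sum_congr rfl fun B' hB' => ?_
    obtain ⟨hB'W, hjB'⟩ := mem_filter.1 hB'
    have hB'sub : B' ⊆ W \ B := mem_powerset.1 hB'W
    have hdisj : Disjoint (B ∪ B') ((W \ B) \ B') := by
      rw [Finset.disjoint_union_left]
      exact ⟨disjoint_sdiff.mono_right sdiff_subset, disjoint_sdiff⟩
    have hdep1 : DependsOn (fun x : ι → X => Φ (x i) (x j) * (uR O x B * uR O x B')) ((B ∪ B' : Finset ι) : Set ι) := by
      intro x y hxy
      have h2 : uR O x B = uR O y B := dependsOn_uR B fun k hk => hxy k (mem_union_left B' hk)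
      have h3 : uR O x B' = uR O y B' := dependsOn_uR B' fun k hk => hxy k (mem_union_right B hk)
      simp only
      rw [hxy i (mem_union_left B' hiB), hxy j (mem_union_right B hjB'), h2, h3]
    have hfac := integral_mul_eq_of_dependsOn ν hdisj
      (F := fun x => Φ (x i) (x j) * (uR O x B * uR O x B')) (G := fun x => efR O x ((W \ B) \ B'))
      (hΦij.mul ((measurable_uR hO B).mul (measurable_uR hO B'))) (measurable_efR hO _) hdep1
      (dependsOn_efR _)
    rw [hfac, integral_efR ν hO]



end Generic

/-! ## § 2 The registered sub-goal -/

/-- **Registered sub-goal `stub_contactStatistics_expansion`** (first piece of stub `stub_contactStatistics`,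
S2c, of the line `enskog-compensator-martingale`): the decorated expansion of the canonical hard-core gas of
`n` independent `ν`-distributed points of `ℝ³` with two marked particles `i, j ∈ W` and a bounded jointly
measurable two-body weight `Φ`:
`∫ Φ(xᵢ,xⱼ) 𝟙[W] dν^{⊗n} = ∑_{B ∋ i,j} (∫ Φ u_B) Ξ(W∖B) + ∑_{B ∋ i, B ∌ j} ∑_{B' ⊆ W∖B, B' ∋ j} (∫ Φ u_B u_{B'}) Ξ((W∖B)∖B')`.
[cite: PulvirentiTsagkarogiannis2012, §3] -/
theorem stub_contactStatistics_expansion : ∀ (n : ℕ) (ν : Measure V3) [IsProbabilityMeasure ν] (O : V3 → V3 → Prop),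
    MeasurableSet {p : V3 × V3 | O p.1 p.2} → ∀ (W : Finset (Fin n)) (i j : Fin n), i ∈ W → j ∈ W →
    ∀ (Φ : V3 → V3 → ℝ), Measurable (fun p : V3 × V3 => Φ p.1 p.2) → ∀ (C : ℝ), (∀ a b, |Φ a b| ≤ C) →
    ∫ x, Φ (x i) (x j) * efR O x W ∂Measure.pi (fun _ : Fin n => ν) =
      (∑ B ∈ (W.powerset.filter (fun B => i ∈ B)).filter (fun B => j ∈ B),
          (∫ x, Φ (x i) (x j) * uR O x B ∂Measure.pi (fun _ : Fin n => ν)) * hcProb O ν (W \ B)) +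
        ∑ B ∈ (W.powerset.filter (fun B => i ∈ B)).filter (fun B => j ∉ B),
          ∑ B' ∈ (W \ B).powerset.filter (fun B' => j ∈ B'),
            (∫ x, Φ (x i) (x j) * (uR O x B * uR O x B') ∂Measure.pi (fun _ : Fin n => ν)) *
              hcProb O ν ((W \ B) \ B') :=
  fun _ ν _ _ hO _ _ _ hi hj _ hΦ _ hΦC => integral_mul₂_efR_eq_sum ν hO hi hj hΦ hΦC

end Summit.AtomisticToContinuum.HydrodynamicLimit.Theorems.EnskogCompensator

end
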